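import Summits.Ventures.LatticeQCDFlow.TrivializingMaps.PlaquetteDecorrelation

/-!
HONEST FRAMING: exact (Metropolis-corrected) sampling algorithms for lattice gauge theory; figures
of merit are autocorrelation/cost numbers at stated couplings and volumes; no continuum-physics
claim.

# WilsonLinkLocality — THE LINK-LOCAL PART `S_e = ∑_{p ∋ e} (N − Re tr ρ(U_p))` OF THE WILSON ACTION:
# LINKS OF A PLAQUETTE, PLAQUETTES THROUGH A LINK (AT MOST `(d+1)d²`), INVARIANCES ALONG HAAR FIBRES,
# OSCILLATION `≤ 2N(d+1)d²` (lean-2 GEN-9, ours)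

Venture-side (OURS).  Cell `lqcd-flow` (pub-lqcd), unit `pub-lqcd-lean-2-g9`, 2026-08-22.  Lattice
bookkeeping for the `β ≠ 0` extensive variance floor (`GibbsFibreVariance` → `GibbsVarianceFloor` →
`WilsonVarianceFloorAllCouplings`): the objects `f_e` the abstract engine is applied to.

* §1 `plaqLinks p` (the four links `(x,i), (x+î,j), (x+ĵ,i), (x,j)` of `p = (x,i,j)`), `plaqThrough e`
  (the plaquettes containing the link `e`), `linkAction ρ e U = ∑_{p ∈ plaqThrough e} (N − Re tr ρ(U_p))`.
* §2 `plaqRe_mulSingle_of_not_mem` (a plaquette not containing `e` does not see the `e`-fibre),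
  **`wilsonAction_sub_linkAction_fibre`** (`S_W − S_e` is invariant along the `e`-fibre),
  **`linkAction_fibre_of_ne`** (`S_e` is invariant along the `e'`-fibre when no plaquette contains both
  `e` and `e'`), `continuous_linkAction`.
* §3 `plaqThrough_subset`, **`card_plaqThrough_le`** (`#plaqThrough e ≤ (d+1)·d²`, every `L`),
  `linkAction_nonneg`, `linkAction_le`, **`linkAction_osc_le`** (`S_e(U) − S_e(V) ≤ 2N(d+1)d²`).

NOT CLAIMED: the exact count `#plaqThrough e = 2(d−1)` (`L ≥ 2`); anything probabilistic (sequels).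
Literature grade (cell rule): bookkeeping; new typing only.
-/

noncomputable section

open MeasureTheory ProbabilityTheory Filter Topology Set
open Literature.MathematicalPhysics.QuantumFieldTheory
open Literature.MathematicalPhysics.QuantumFieldTheory.Luscher2010

namespace Summit.Ventures.LatticeQCDFlow.TrivializingMaps

variable {d L N : ℕ} [NeZero L] {G : Type*} [Group G]

/-! ## §1 Links of a plaquette, plaquettes through a link, the link-local action -/

/-- The four links `(x,i), (x+î,j), (x+ĵ,i), (x,j)` of the plaquette `p = (x, i, j)` — exactly the bond
variables entering `plaquetteHolonomy U x i j`. [folklore] -/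
def plaqLinks (p : Plaquette d L) : Finset (Edge d L) :=
  {(p.1, p.2.1.1), (p.1.shift p.2.1.1, p.2.1.2), (p.1.shift p.2.1.2, p.2.1.1), (p.1, p.2.1.2)}

omit [NeZero L] in
/-- Membership in `plaqLinks`. [folklore] -/
theorem mem_plaqLinks_iff (p : Plaquette d L) (e : Edge d L) :
    e ∈ plaqLinks p ↔ e = (p.1, p.2.1.1) ∨ e = (p.1.shift p.2.1.1, p.2.1.2) ∨
      e = (p.1.shift p.2.1.2, p.2.1.1) ∨ e = (p.1, p.2.1.2) := by
  simp only [plaqLinks, Finset.mem_insert, Finset.mem_singleton]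

/-- The plaquettes through the link `e`. [folklore] -/
def plaqThrough (e : Edge d L) : Finset (Plaquette d L) :=
  Finset.univ.filter fun p => e ∈ plaqLinks p

/-- Membership in `plaqThrough`. [folklore] -/
theorem mem_plaqThrough_iff (e : Edge d L) (p : Plaquette d L) : p ∈ plaqThrough e ↔ e ∈ plaqLinks p := by
  simp [plaqThrough]

variable (ρ : G →* Matrix (Fin N) (Fin N) ℂ)

/-- **The link-local part of the Wilson action**: `S_e(U) = ∑_{p ∋ e} (N − Re tr ρ(U_p))`, the part of
`S_W` that sees the link `e`. [folklore] -/
def linkAction (e : Edge d L) (U : GaugeConfig d L G) : ℝ :=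
  ∑ p ∈ plaqThrough e, ((N : ℝ) - WilsonRP.plaqRe ρ U p)

/-! ## §2 Invariances along Haar fibres -/

section Fibre

omit [NeZero L] in
/-- A plaquette holonomy only sees its own four links (the canonical `DecidableEq (Edge d L)` instance
is used for `Pi.mulSingle` throughout this file and its sequels). [folklore] -/
theorem plaquetteHolonomy_mulSingle_of_not_mem {p : Plaquette d L} {e : Edge d L}
    (he : e ∉ plaqLinks p) (h : G) (U : GaugeConfig d L G) :
    plaquetteHolonomy (Pi.mulSingle e h * U) p.1 p.2.1.1 p.2.1.2 =
      plaquetteHolonomy U p.1 p.2.1.1 p.2.1.2 := by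
  simp only [mem_plaqLinks_iff, not_or] at he
  exact plaquetteHolonomy_mulSingle_of_ne U p.1 p.2.1.1 p.2.1.2 he.1 he.2.1 he.2.2.1 he.2.2.2 h

omit [NeZero L] in
/-- **A plaquette not containing `e` does not see the `e`-fibre**: `Re tr ρ((h ·_e U)_p) = Re tr ρ(U_p)`.
[folklore] -/
theorem plaqRe_mulSingle_of_not_mem {p : Plaquette d L} {e : Edge d L} (he : e ∉ plaqLinks p) (h : G)
    (U : GaugeConfig d L G) :
    WilsonRP.plaqRe ρ (Pi.mulSingle e h * U) p = WilsonRP.plaqRe ρ U p := by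
  unfold WilsonRP.plaqRe
  rw [plaquetteHolonomy_mulSingle_of_not_mem he]

/-- `S_W = S_e + ∑_{p ∌ e} (N − Re tr ρ(U_p))`. [folklore] -/
theorem wilsonAction_eq_linkAction_add (e : Edge d L) (U : GaugeConfig d L G) :
    wilsonAction ρ U = linkAction ρ e U +
      ∑ p ∈ Finset.univ.filter (fun p : Plaquette d L => e ∉ plaqLinks p), ((N : ℝ) - WilsonRP.plaqRe ρ U p) := by
  have h : wilsonAction ρ U = ∑ p : Plaquette d L, ((N : ℝ) - WilsonRP.plaqRe ρ U p) := rfl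
  rw [h, linkAction, plaqThrough]
  exact (Finset.sum_filter_add_sum_filter_not Finset.univ (fun p : Plaquette d L => e ∈ plaqLinks p)
    (fun p => (N : ℝ) - WilsonRP.plaqRe ρ U p)).symm

/-- **`S_W − S_e` is invariant along the `e`-fibre.** [ours] -/
theorem wilsonAction_sub_linkAction_fibre (e : Edge d L) (h : G) (U : GaugeConfig d L G) :
    wilsonAction ρ (Pi.mulSingle e h * U) - linkAction ρ e (Pi.mulSingle e h * U) =
      wilsonAction ρ U - linkAction ρ e U := by
  rw [wilsonAction_eq_linkAction_add ρ e, wilsonAction_eq_linkAction_add ρ e U, add_sub_cancel_left,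
    add_sub_cancel_left]
  refine Finset.sum_congr rfl fun p hp => ?_
  rw [plaqRe_mulSingle_of_not_mem ρ (Finset.mem_filter.1 hp).2]

/-- **`S_e` is invariant along the `e'`-fibre when no plaquette contains both `e` and `e'`.** [ours] -/
theorem linkAction_fibre_of_ne {e e' : Edge d L} (hee' : ∀ p : Plaquette d L, e ∈ plaqLinks p → e' ∉ plaqLinks p)
    (h : G) (U : GaugeConfig d L G) :
    linkAction ρ e (Pi.mulSingle e' h * U) = linkAction ρ e U := by
  unfold linkAction
  refine Finset.sum_congr rfl fun p hp => ?_
  rw [plaqRe_mulSingle_of_not_mem ρ (hee' p ((mem_plaqThrough_iff e p).1 hp))]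

end Fibre

/-- `S_e` is continuous for continuous `ρ`. [folklore] -/
theorem continuous_linkAction [TopologicalSpace G] [IsTopologicalGroup G] (hρ : Continuous ρ) (e : Edge d L) :
    Continuous (linkAction (d := d) (L := L) ρ e) := by
  unfold linkAction WilsonRP.plaqRe
  refine continuous_finsetSum _ fun p _ => continuous_const.sub ?_
  refine Complex.continuous_re.comp ((Continuous.matrix_trace hρ).comp ?_)
  unfold plaquetteHolonomy; fun_prop

/-! ## §3 Counting the plaquettes through a link; oscillation of `S_e` -/

/-- The base sites of the plaquettes through `e = (x, k)`: `x` and the `x − m̂`. [folklore] -/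
theorem plaqThrough_subset (e : Edge d L) :
    plaqThrough e ⊆ Finset.univ.filter fun p : Plaquette d L =>
      p.1 ∈ insert e.1 (Finset.univ.image fun m : Fin d => e.1 - Pi.single m 1) := by
  intro p hp
  rw [mem_plaqThrough_iff, mem_plaqLinks_iff] at hp
  simp only [Finset.mem_filter, Finset.mem_univ, true_and, Finset.mem_insert, Finset.mem_image]
  rcases hp with h | h | h | h
  · exact Or.inl (by rw [h])
  · refine Or.inr ⟨p.2.1.1, ?_⟩
    rw [h]; simp [Site.shift]
  · refine Or.inr ⟨p.2.1.2, ?_⟩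
    rw [h]; simp [Site.shift]
  · exact Or.inl (by rw [h])

/-- **At most `(d+1)·d²` plaquettes pass through a link** (every `L`; the exact count for `L ≥ 2` is
`2(d−1)`). [folklore] -/
theorem card_plaqThrough_le (e : Edge d L) : (plaqThrough e).card ≤ (d + 1) * d ^ 2 := by
  classical
  set T : Finset (Site d L) := insert e.1 (Finset.univ.image fun m : Fin d => e.1 - Pi.single m 1) with hT
  have hTcard : T.card ≤ d + 1 := by
    rw [hT]
    refine (Finset.card_insert_le _ _).trans ?_
    have := Finset.card_image_le (s := (Finset.univ : Finset (Fin d))) (f := fun m : Fin d => e.1 - Pi.single m 1)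
    rw [Finset.card_univ, Fintype.card_fin] at this
    omega
  have hprod : (Finset.univ.filter fun p : Plaquette d L => p.1 ∈ T) = T ×ˢ Finset.univ := by
    ext p
    simp only [Finset.mem_filter, Finset.mem_univ, true_and, Finset.mem_product, and_true]
  have hpairs : Fintype.card {q : Fin d × Fin d // q.1 < q.2} ≤ d ^ 2 := by
    refine (Fintype.card_subtype_le _).trans ?_
    rw [Fintype.card_prod, Fintype.card_fin, sq]
  calc (plaqThrough e).card ≤ (Finset.univ.filter fun p : Plaquette d L => p.1 ∈ T).card :=
        Finset.card_le_card (plaqThrough_subset e)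
    _ = T.card * Fintype.card {q : Fin d × Fin d // q.1 < q.2} := by
        rw [hprod, Finset.card_product, Finset.card_univ]
    _ ≤ (d + 1) * d ^ 2 := Nat.mul_le_mul hTcard hpairs

variable [TopologicalSpace G] [IsTopologicalGroup G] [CompactSpace G]

/-- `0 ≤ S_e` (`|Re tr ρ| ≤ N`). [folklore] -/
theorem linkAction_nonneg (hρ : Continuous ρ) (e : Edge d L) (U : GaugeConfig d L G) :
    0 ≤ linkAction ρ e U := by
  unfold linkAction
  refine Finset.sum_nonneg fun p _ => ?_
  have := (abs_le.1 (WilsonRP.abs_plaqRe_le ρ hρ U p)).2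
  linarith

/-- `S_e ≤ 2N · #plaqThrough e`. [folklore] -/
theorem linkAction_le (hρ : Continuous ρ) (e : Edge d L) (U : GaugeConfig d L G) :
    linkAction ρ e U ≤ 2 * N * (plaqThrough e).card := by
  unfold linkAction
  calc ∑ p ∈ plaqThrough e, ((N : ℝ) - WilsonRP.plaqRe ρ U p) ≤ ∑ _p ∈ plaqThrough e, (2 * (N : ℝ)) :=
        Finset.sum_le_sum fun p _ => by
          have := (abs_le.1 (WilsonRP.abs_plaqRe_le ρ hρ U p)).1
          linarith
    _ = 2 * N * (plaqThrough e).card := by rw [Finset.sum_const, nsmul_eq_mul]; ring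

/-- **Oscillation of the link-local action**: `S_e(U) − S_e(V) ≤ 2N(d+1)d²`, every `L`, every
configuration pair. [ours] -/
theorem linkAction_osc_le (hρ : Continuous ρ) (e : Edge d L) (U V : GaugeConfig d L G) :
    linkAction ρ e U - linkAction ρ e V ≤ 2 * N * ((d + 1) * d ^ 2 : ℕ) := by
  have h1 := linkAction_le ρ hρ e U
  have h2 := linkAction_nonneg ρ hρ e V
  have h3 : (2 : ℝ) * N * (plaqThrough e).card ≤ 2 * N * ((d + 1) * d ^ 2 : ℕ) := by
    have := card_plaqThrough_le (d := d) (L := L) e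
    have h0 : (0 : ℝ) ≤ 2 * N := by positivity
    exact mul_le_mul_of_nonneg_left (by exact_mod_cast this) h0
  linarith

end Summit.Ventures.LatticeQCDFlow.TrivializingMaps
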